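import Mathlib.NumberTheory.NumberField.Completion.FinitePlace
import Mathlib.Algebra.Polynomial.Taylor
import Mathlib.Analysis.Normed.Group.Ultra
import Mathlib.Analysis.Normed.Ring.Ultra
import Mathlib.Topology.MetricSpace.Contracting
import HarnessLib

/-!
# R90-TF · S3, (U3-F) brick P2: SIMPLE ROOTS MOVE CONTINUOUSLY INSIDE A COMPLETE NON-ARCHIMEDEAN FIELD (strong Hensel by contraction)
# (`Theorems/R90S3RootNearInCompletion.lean`; dealer R90-C12-plan (g2) memo `DEAL-S3-U3F-SPLIT.v1.md` §1 row P2, dealt to K2E4-p14 (g12) 2026-09-05T00:28:36Z)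

Cell `hodgecm-mathlib`, crux H413 (`stmt-HodgeConjecture-24833`), route of record `HCCMUnconditional`; programme R90-TF, section S3 (base `R90-C12`), the (U3-F)
auxiliary-globalisation residual `stub_R90_S3_auxGlobaliseField` (ℚ-planted road): brick P2 supplies, for the PLANTED integer polynomial `f` close to a local target
`g = (X − β₀)·∏(X − cᵢ)` (P3), roots of `f` INSIDE the completion `K = L⁺_v` near the roots of `g` (consumed by P8 to build the dense embedding `J` of P1 ★ p863617).
Lane `--supports stmt-HodgeConjecture-24833 --as helper`; THEOREMS ONLY; Mathlib-only imports; ns `…R90.S3`.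

CENSUS (bus 00:32:30Z): the tree's root-continuity kit (`Resolution/RootContinuityUltrametric`) lives in an ALGEBRAICALLY CLOSED valued field and Mathlib's
`Polynomial.exists_roots_norm_sub_lt_of_norm_coeff_sub_lt` needs the perturbed polynomial to SPLIT — both give roots outside `K`; Mathlib's Hensel
(`HenselianLocalRing`) is the unit-derivative form.  What the planted road needs is the STRONG form `|f(a)| < |f′(a)|²` with roots IN `K`, proved here from scratch:

THE MATHEMATICS [Neukirch, *ANT*, II (4.6) (Hensel) and its proof by Newton approximation; Serre, *Local Fields*, II §2; Lang, *ANT*, II §2 Prop. 2].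
`K` a complete non-archimedean normed field, `p ∈ K[X]` with coefficients of norm `≤ 1`, `a` with `‖a‖ ≤ 1`, `t := p′(a)`.
* §1 estimates: `‖p(x)‖ ≤ sup ‖pᵢ‖` on the unit ball; the Taylor coefficients of `p` at `a` have norm `≤ 1` (Mathlib `Polynomial.taylor`, `hasseDeriv_coeff`); the KEY
  two-variable estimate `‖p(x) − p(y) − p′(a)(x − y)‖ ≤ ρ·‖x − y‖` for `‖x − a‖, ‖y − a‖ ≤ ρ ≤ 1` (`xᵏ − yᵏ = (x − y)·Σ xⁱyᵏ⁻¹⁻ⁱ`, Mathlib `geom_sum₂_mul`).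
* §2 STRONG HENSEL `exists_isRoot_of_norm_eval_lt_sq`: if `‖p(a)‖ < ‖p′(a)‖²` then `p` has a root `b ∈ K` with `‖b − a‖ ≤ ‖p(a)‖ ∕ ‖p′(a)‖` and `‖p′(b)‖ = ‖p′(a)‖` —
  the simplified Newton map `x ↦ x − p(x)∕t` is a `ρ∕‖t‖`-contraction of the complete closed ball `‖x − a‖ ≤ ρ := ‖p(a)‖∕‖t‖ (< ‖t‖)` (Mathlib
  `ContractingWith.fixedPoint`).
* §3 HEAD `exists_isRoot_norm_sub_le_of_coeff_close`: `g` integral with a root `r`, `‖r‖ ≤ 1`, `f` integral with `‖fᵢ − gᵢ‖ ≤ δ < ‖g′(r)‖²` for all `i` ⇒ `f` has a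
  root `r′ ∈ K` with `‖r′ − r‖ ≤ δ ∕ ‖g′(r)‖` and `‖f′(r′)‖ = ‖g′(r)‖` (so simple roots stay simple and, for `δ` small, distinct roots stay distinct); the
  finite-family form `forall_exists_isRoot_norm_sub_le_of_coeff_close`; and the instance check at `K := L_w` (`…_adicCompletion`).
HONEST LABEL: P2 is a sub-brick of the GENUINE residual (U3-F) and closes nothing alone; HC_CM is proved only modulo the 7 printed citations (2 remaining named
inputs: hLiu418 = stmt-HodgeConjecture-24832, h413 = stmt-HodgeConjecture-24833) until rung 0 closes; count-neutral helper.

## References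
* [NeukirchANT1999] J. Neukirch, *Algebraic Number Theory*, Grundlehren 322 (1999), Ch. II (4.6) and the Newton-approximation remark following it.
* [Serre1979] J.-P. Serre, *Local Fields*, GTM 67 (1979), Ch. II §2.
-/

set_option autoImplicit false
-- the mandated namespace repeats the single-problem summit's segment (`HodgeConjecture.HodgeConjecture`)
set_option linter.dupNamespace false

noncomputable section

open Polynomial IsDedekindDomain NumberField

namespace Summit.HodgeConjecture.HodgeConjecture.R90.S3

section Ultrametric

variable {K : Type*} [NormedField K] [IsUltrametricDist K]

/-! ## §1 Ultrametric estimates for integral polynomials -/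

/-- On the unit ball an integral-type bound on the coefficients bounds the value: `‖pᵢ‖ ≤ C` for all `i` and `‖x‖ ≤ 1` give `‖p(x)‖ ≤ C`. [cite: Serre1979, Ch. II §2] -/
theorem norm_eval_le_of_forall_norm_coeff_le {p : K[X]} {C : ℝ} (hC : 0 ≤ C) (hp : ∀ i, ‖p.coeff i‖ ≤ C) {x : K} (hx : ‖x‖ ≤ 1) :
    ‖p.eval x‖ ≤ C := by
  rw [eval_eq_sum_range]
  refine IsUltrametricDist.norm_sum_le_of_forall_le_of_nonneg hC fun i _ => ?_
  rw [norm_mul, norm_pow]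
  exact (mul_le_mul (hp i) (pow_le_one₀ (norm_nonneg _) hx) (pow_nonneg (norm_nonneg _) _) hC).trans_eq (mul_one C)

/-- The derivative of a polynomial with `‖pᵢ‖ ≤ C` has `‖p′ᵢ‖ ≤ C` (`‖n‖ ≤ 1` in an ultrametric field). [cite: Serre1979, Ch. II §2] -/
theorem norm_coeff_derivative_le {p : K[X]} {C : ℝ} (hC : 0 ≤ C) (hp : ∀ i, ‖p.coeff i‖ ≤ C) (i : ℕ) : ‖p.derivative.coeff i‖ ≤ C := by
  rw [coeff_derivative, norm_mul]
  calc ‖p.coeff (i + 1)‖ * ‖((i : K) + 1)‖ ≤ C * 1 :=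
        mul_le_mul (hp _) (by exact_mod_cast IsUltrametricDist.norm_natCast_le_one K (i + 1)) (norm_nonneg _) hC
    _ = C := mul_one C

/-- The Taylor coefficients at an integral point of an integral polynomial are integral: `‖(taylor a p)ₙ‖ ≤ 1` (`(taylor a p)ₙ = (Dⁿ p)(a)` and the Hasse derivative
has coefficients `binomial · pᵢ`). [cite: Serre1979, Ch. II §2] -/
theorem norm_coeff_taylor_le_one {p : K[X]} (hp : ∀ i, ‖p.coeff i‖ ≤ 1) {a : K} (ha : ‖a‖ ≤ 1) (n : ℕ) : ‖(taylor a p).coeff n‖ ≤ 1 := by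
  rw [taylor_coeff]
  refine norm_eval_le_of_forall_norm_coeff_le zero_le_one (fun i => ?_) ha
  rw [hasseDeriv_coeff, norm_mul]
  calc ‖((((i + n).choose n : ℕ) : K))‖ * ‖p.coeff (i + n)‖ ≤ 1 * 1 :=
        mul_le_mul (IsUltrametricDist.norm_natCast_le_one K _) (hp _) (norm_nonneg _) zero_le_one
    _ = 1 := mul_one 1

/-- `‖xᵏ − yᵏ‖ ≤ ρᵏ⁻¹·‖x − y‖` for `‖x‖, ‖y‖ ≤ ρ` and `k ≥ 1` (`xᵏ − yᵏ = (Σ xⁱ yᵏ⁻¹⁻ⁱ)(x − y)`, Mathlib `geom_sum₂_mul`). [cite: Serre1979, Ch. II §2] -/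
theorem norm_pow_sub_pow_le {x y : K} {ρ : ℝ} (hρ : 0 ≤ ρ) (hx : ‖x‖ ≤ ρ) (hy : ‖y‖ ≤ ρ) {k : ℕ} (hk : 1 ≤ k) :
    ‖x ^ k - y ^ k‖ ≤ ρ ^ (k - 1) * ‖x - y‖ := by
  rw [← geom_sum₂_mul, norm_mul]
  refine mul_le_mul_of_nonneg_right ?_ (norm_nonneg _)
  refine IsUltrametricDist.norm_sum_le_of_forall_le_of_nonneg (pow_nonneg hρ _) fun i hi => ?_
  rw [Finset.mem_range] at hi
  rw [norm_mul, norm_pow, norm_pow]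
  calc ‖x‖ ^ i * ‖y‖ ^ (k - 1 - i) ≤ ρ ^ i * ρ ^ (k - 1 - i) :=
        mul_le_mul (pow_le_pow_left₀ (norm_nonneg _) hx i) (pow_le_pow_left₀ (norm_nonneg _) hy _) (pow_nonneg (norm_nonneg _) _) (pow_nonneg hρ _)
    _ = ρ ^ (k - 1) := by rw [← pow_add]; congr 1; omega

/-- **KEY TWO-VARIABLE TAYLOR ESTIMATE**: for `p` integral, `‖a‖ ≤ 1` and `x, y` in the closed ball `‖· − a‖ ≤ ρ ≤ 1`,
`‖p(x) − p(y) − p′(a)·(x − y)‖ ≤ ρ·‖x − y‖` (expand `p` at `a`; the terms of order `k ≥ 2` contribute `(taylor a p)ₖ·(uᵏ − wᵏ)`, `u = x − a`, `w = y − a`).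
[cite: NeukirchANT1999, Ch. II (4.6)] [cite: Serre1979, Ch. II §2] -/
theorem norm_eval_sub_eval_sub_mul_le {p : K[X]} (hp : ∀ i, ‖p.coeff i‖ ≤ 1) {a : K} (ha : ‖a‖ ≤ 1) {ρ : ℝ} (hρ0 : 0 ≤ ρ) (hρ1 : ρ ≤ 1)
    {x y : K} (hx : ‖x - a‖ ≤ ρ) (hy : ‖y - a‖ ≤ ρ) :
    ‖p.eval x - p.eval y - p.derivative.eval a * (x - y)‖ ≤ ρ * ‖x - y‖ := by
  set q := taylor a p with hq
  set u := x - a with hu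
  set w := y - a with hw
  have hxq : p.eval x = q.eval u := by rw [hq, taylor_eval, hu, sub_add_cancel]
  have hyq : p.eval y = q.eval w := by rw [hq, taylor_eval, hw, sub_add_cancel]
  have hd : p.derivative.eval a = q.coeff 1 := by rw [hq, taylor_coeff_one]
  have hxy : x - y = u - w := by rw [hu, hw]; ring
  set n := q.natDegree + 2 with hn
  have hlt : q.natDegree < n := by omega
  have h1 : (1 : ℕ) ∈ Finset.range n := by rw [Finset.mem_range]; omega
  rw [hxq, hyq, hd, hxy, eval_eq_sum_range' hlt, eval_eq_sum_range' hlt, ← Finset.sum_sub_distrib]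
  have hsum : ∑ k ∈ Finset.range n, (q.coeff k * u ^ k - q.coeff k * w ^ k) = ∑ k ∈ Finset.range n, q.coeff k * (u ^ k - w ^ k) :=
    Finset.sum_congr rfl fun k _ => by ring
  rw [hsum, ← Finset.sum_erase_add _ _ h1, pow_one, pow_one, add_sub_cancel_right]
  refine IsUltrametricDist.norm_sum_le_of_forall_le_of_nonneg (mul_nonneg hρ0 (norm_nonneg _)) fun k hk => ?_
  rw [Finset.mem_erase] at hk
  rcases Nat.lt_or_ge k 1 with hk0 | hk1
  · have hk0' : k = 0 := by omega
    subst hk0'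
    simp only [pow_zero, sub_self, mul_zero, norm_zero]
    exact mul_nonneg hρ0 (norm_nonneg _)
  · have hk2 : 2 ≤ k := by omega
    rw [norm_mul]
    calc ‖q.coeff k‖ * ‖u ^ k - w ^ k‖ ≤ 1 * (ρ ^ (k - 1) * ‖u - w‖) :=
          mul_le_mul (norm_coeff_taylor_le_one hp ha k) (norm_pow_sub_pow_le hρ0 hx hy hk1) (norm_nonneg _) zero_le_one
      _ ≤ ρ * ‖u - w‖ := by
          rw [one_mul]
          exact mul_le_mul_of_nonneg_right (pow_le_of_le_one hρ0 hρ1 (by omega)) (norm_nonneg _)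

/-- Lipschitz bound on the unit ball: for `p` integral and `‖x − a‖, ‖y − a‖ ≤ 1` (`‖a‖ ≤ 1`), `‖p(x) − p(y)‖ ≤ ‖x − y‖`. [cite: Serre1979, Ch. II §2] -/
theorem norm_eval_sub_eval_le {p : K[X]} (hp : ∀ i, ‖p.coeff i‖ ≤ 1) {a : K} (ha : ‖a‖ ≤ 1) {x y : K} (hx : ‖x - a‖ ≤ 1) (hy : ‖y - a‖ ≤ 1) :
    ‖p.eval x - p.eval y‖ ≤ ‖x - y‖ := by
  have h1 := norm_eval_sub_eval_sub_mul_le hp ha zero_le_one le_rfl hx hy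
  rw [one_mul] at h1
  have h2 : ‖p.derivative.eval a * (x - y)‖ ≤ ‖x - y‖ := by
    rw [norm_mul]
    calc ‖p.derivative.eval a‖ * ‖x - y‖ ≤ 1 * ‖x - y‖ :=
          mul_le_mul_of_nonneg_right (norm_eval_le_of_forall_norm_coeff_le zero_le_one (norm_coeff_derivative_le zero_le_one hp) ha) (norm_nonneg _)
      _ = ‖x - y‖ := one_mul _
  calc ‖p.eval x - p.eval y‖ = ‖(p.eval x - p.eval y - p.derivative.eval a * (x - y)) + p.derivative.eval a * (x - y)‖ := by rw [sub_add_cancel]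
    _ ≤ max ‖p.eval x - p.eval y - p.derivative.eval a * (x - y)‖ ‖p.derivative.eval a * (x - y)‖ := IsUltrametricDist.norm_add_le_max _ _
    _ ≤ ‖x - y‖ := max_le h1 h2

/-! ## §2 STRONG HENSEL in a complete non-archimedean field, by the contraction principle -/

/-- **STRONG HENSEL'S LEMMA IN `K` (Newton form).**  `K` complete non-archimedean, `p ∈ K[X]` with `‖pᵢ‖ ≤ 1`, `‖a‖ ≤ 1` and `‖p(a)‖ < ‖p′(a)‖²`: there is a ROOT `b ∈ K`
of `p` with `‖b − a‖ ≤ ‖p(a)‖ ∕ ‖p′(a)‖` (`< ‖p′(a)‖`) and `‖p′(b)‖ = ‖p′(a)‖`.  Proof: with `t = p′(a)`, `ρ = ‖p(a)‖∕‖t‖`, the map `N(x) = x − p(x)∕t` sends the complete closed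
ball `‖x − a‖ ≤ ρ` into itself and is a contraction with constant `ρ∕‖t‖ < 1` by `norm_eval_sub_eval_sub_mul_le`; its fixed point (Mathlib `ContractingWith.fixedPoint`) is
the root. [cite: NeukirchANT1999, Ch. II (4.6)] [cite: Serre1979, Ch. II §2] -/
theorem exists_isRoot_of_norm_eval_lt_sq [CompleteSpace K] {p : K[X]} (hp : ∀ i, ‖p.coeff i‖ ≤ 1) {a : K} (ha : ‖a‖ ≤ 1)
    (h : ‖p.eval a‖ < ‖p.derivative.eval a‖ ^ 2) :
    ∃ b : K, p.IsRoot b ∧ ‖b - a‖ ≤ ‖p.eval a‖ / ‖p.derivative.eval a‖ ∧ ‖p.derivative.eval b‖ = ‖p.derivative.eval a‖ := by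
  set t := p.derivative.eval a with ht
  have htpos : 0 < ‖t‖ := by
    rcases (norm_nonneg t).eq_or_lt with h0 | h0
    · rw [← h0, sq, mul_zero] at h
      exact absurd h (not_lt.2 (norm_nonneg _))
    · exact h0
  have ht0 : t ≠ 0 := norm_pos_iff.1 htpos
  have ht1 : ‖t‖ ≤ 1 := norm_eval_le_of_forall_norm_coeff_le zero_le_one (norm_coeff_derivative_le zero_le_one hp) ha
  set ρ := ‖p.eval a‖ / ‖t‖ with hρ
  have hρ0 : 0 ≤ ρ := div_nonneg (norm_nonneg _) htpos.le
  have hρt : ρ < ‖t‖ := by rw [hρ, div_lt_iff₀ htpos, ← sq]; exact h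
  have hρ1 : ρ ≤ 1 := hρt.le.trans ht1
  have hpa : ‖p.eval a‖ = ρ * ‖t‖ := by rw [hρ, div_mul_cancel₀ _ htpos.ne']
  -- the complete closed ball and the Newton map on it
  set S : Set K := Metric.closedBall a ρ with hS
  have hmemS : ∀ {x : K}, x ∈ S ↔ ‖x - a‖ ≤ ρ := fun {x} => by rw [hS, Metric.mem_closedBall, dist_eq_norm]
  haveI : CompleteSpace S := Metric.isClosed_closedBall.completeSpace_coe
  haveI : Nonempty S := ⟨⟨a, Metric.mem_closedBall_self hρ0⟩⟩
  have hmaps : ∀ x ∈ S, x - p.eval x / t ∈ S := by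
    intro x hx
    rw [hmemS] at hx ⊢
    have hE := norm_eval_sub_eval_sub_mul_le hp ha hρ0 hρ1 hx (show ‖a - a‖ ≤ ρ by rw [sub_self, norm_zero]; exact hρ0)
    have hkey : ‖(x - a) * t - p.eval x‖ ≤ ρ * ‖t‖ := by
      have hrw : (x - a) * t - p.eval x = -((p.eval x - p.eval a - p.derivative.eval a * (x - a)) + p.eval a) := by rw [← ht]; ring
      rw [hrw, norm_neg]
      refine (IsUltrametricDist.norm_add_le_max _ _).trans (max_le ?_ hpa.le)
      calc ‖p.eval x - p.eval a - p.derivative.eval a * (x - a)‖ ≤ ρ * ‖x - a‖ := hE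
        _ ≤ ρ * ρ := mul_le_mul_of_nonneg_left hx hρ0
        _ ≤ ρ * ‖t‖ := mul_le_mul_of_nonneg_left hρt.le hρ0
    have hrw2 : x - p.eval x / t - a = ((x - a) * t - p.eval x) / t := by
      field_simp
      ring
    rw [hrw2, norm_div, div_le_iff₀ htpos]
    exact hkey
  let N : S → S := fun x => ⟨x.1 - p.eval x.1 / t, hmaps x.1 x.2⟩
  have hN_apply : ∀ x : S, ((N x : S) : K) = x.1 - p.eval x.1 / t := fun x => rfl
  -- contraction constant `κ = ρ ∕ ‖t‖ < 1`
  set κ : NNReal := ⟨ρ / ‖t‖, div_nonneg hρ0 htpos.le⟩ with hκ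
  have hκval : (κ : ℝ) = ρ / ‖t‖ := rfl
  have hκ1 : κ < 1 := by
    rw [← NNReal.coe_lt_coe, hκval, NNReal.coe_one]
    exact (div_lt_one htpos).2 hρt
  have hN : ContractingWith κ N := by
    refine ⟨hκ1, LipschitzWith.of_dist_le_mul fun x y => ?_⟩
    rw [Subtype.dist_eq, Subtype.dist_eq, dist_eq_norm, dist_eq_norm, hN_apply, hN_apply, hκval]
    have hx := (hmemS.1 x.2)
    have hy := (hmemS.1 y.2)
    have hT0 : ‖t‖ ≠ 0 := htpos.ne'
    have hrw : x.1 - p.eval x.1 / t - (y.1 - p.eval y.1 / t) = -(p.eval x.1 - p.eval y.1 - p.derivative.eval a * (x.1 - y.1)) / t := by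
      rw [← ht]
      field_simp
      ring
    rw [hrw, norm_div, norm_neg, div_le_iff₀ htpos]
    calc ‖p.eval x.1 - p.eval y.1 - p.derivative.eval a * (x.1 - y.1)‖ ≤ ρ * ‖x.1 - y.1‖ := norm_eval_sub_eval_sub_mul_le hp ha hρ0 hρ1 hx hy
      _ = ρ / ‖t‖ * ‖x.1 - y.1‖ * ‖t‖ := by
          field_simp
  -- the fixed point is the root
  obtain ⟨b, hb⟩ : ∃ b : S, N b = b := ⟨ContractingWith.fixedPoint N hN, hN.fixedPoint_isFixedPt⟩
  have hbS := hmemS.1 b.2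
  have hroot : p.eval b.1 = 0 := by
    have h1 : ((N b : S) : K) = b.1 := congrArg Subtype.val hb
    rw [hN_apply, sub_eq_self, div_eq_zero_iff] at h1
    exact h1.resolve_right ht0
  refine ⟨b.1, hroot, hbS, ?_⟩
  -- `‖p′(b)‖ = ‖p′(a)‖`: `p′` is `1`-Lipschitz on the unit ball and `‖b − a‖ ≤ ρ < ‖t‖`
  have hd : ‖p.derivative.eval b.1 - p.derivative.eval a‖ < ‖p.derivative.eval a‖ := by
    refine lt_of_le_of_lt ?_ hρt
    exact (norm_eval_sub_eval_le (norm_coeff_derivative_le zero_le_one hp) ha (hbS.trans hρ1)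
      (show ‖a - a‖ ≤ 1 by rw [sub_self, norm_zero]; exact zero_le_one)).trans hbS
  calc ‖p.derivative.eval b.1‖ = ‖(p.derivative.eval b.1 - p.derivative.eval a) + p.derivative.eval a‖ := by rw [sub_add_cancel]
    _ = max ‖p.derivative.eval b.1 - p.derivative.eval a‖ ‖p.derivative.eval a‖ :=
        IsUltrametricDist.norm_add_eq_max_of_norm_ne_norm hd.ne
    _ = ‖p.derivative.eval a‖ := max_eq_right hd.le

/-! ## §3 HEAD: continuity of a simple root under perturbation of the coefficients -/

/-- **P2 — A SIMPLE ROOT MOVES CONTINUOUSLY WITH THE COEFFICIENTS, INSIDE `K`.**  `K` complete non-archimedean; `g ∈ K[X]` integral with a root `r`, `‖r‖ ≤ 1`;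
`f ∈ K[X]` integral with `‖fᵢ − gᵢ‖ ≤ δ` for all `i`, where `δ < ‖g′(r)‖²`.  Then `f` has a root `r′ ∈ K` with `‖r′ − r‖ ≤ δ ∕ ‖g′(r)‖` and `‖f′(r′)‖ = ‖g′(r)‖`
(`‖f(r)‖ = ‖(f − g)(r)‖ ≤ δ`, `‖f′(r)‖ = ‖g′(r)‖` since `‖(f − g)′(r)‖ ≤ δ < ‖g′(r)‖² ≤ ‖g′(r)‖`, then §2). [cite: NeukirchANT1999, Ch. II (4.6)] [cite: Serre1979, Ch. II §2] -/
theorem exists_isRoot_norm_sub_le_of_coeff_close [CompleteSpace K] {f g : K[X]} (hf : ∀ i, ‖f.coeff i‖ ≤ 1) (hg : ∀ i, ‖g.coeff i‖ ≤ 1)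
    {r : K} (hr : ‖r‖ ≤ 1) (hgr : g.IsRoot r) {δ : ℝ} (hδ : δ < ‖g.derivative.eval r‖ ^ 2) (hclose : ∀ i, ‖f.coeff i - g.coeff i‖ ≤ δ) :
    ∃ r' : K, f.IsRoot r' ∧ ‖r' - r‖ ≤ δ / ‖g.derivative.eval r‖ ∧ ‖f.derivative.eval r'‖ = ‖g.derivative.eval r‖ := by
  have hδ0 : 0 ≤ δ := (norm_nonneg _).trans (hclose 0)
  set Λ := ‖g.derivative.eval r‖ with hΛ
  have hΛ1 : Λ ≤ 1 := norm_eval_le_of_forall_norm_coeff_le zero_le_one (norm_coeff_derivative_le zero_le_one hg) hr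
  have hΛpos : 0 < Λ := by
    rcases (norm_nonneg (g.derivative.eval r)).eq_or_lt with h0 | h0
    · have hΛ0 : Λ = 0 := by rw [hΛ, ← h0]
      rw [hΛ0, sq, mul_zero] at hδ
      exact absurd (hδ0.trans_lt hδ) (lt_irrefl 0)
    · exact h0
  have hsub : ∀ i, ‖(f - g).coeff i‖ ≤ δ := fun i => by rw [coeff_sub]; exact hclose i
  -- `‖f(r)‖ ≤ δ`
  have hfr : ‖f.eval r‖ ≤ δ := by
    have h1 : f.eval r = (f - g).eval r := by rw [eval_sub, hgr.eq_zero, sub_zero]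
    rw [h1]
    exact norm_eval_le_of_forall_norm_coeff_le hδ0 hsub hr
  -- `‖f′(r)‖ = Λ`
  have hfd : ‖f.derivative.eval r‖ = Λ := by
    have h1 : ‖f.derivative.eval r - g.derivative.eval r‖ < ‖g.derivative.eval r‖ := by
      rw [← eval_sub, ← derivative_sub]
      refine lt_of_le_of_lt (norm_eval_le_of_forall_norm_coeff_le hδ0 (norm_coeff_derivative_le hδ0 hsub) hr) (hδ.trans_le ?_)
      rw [← hΛ, sq]
      exact (mul_le_mul_of_nonneg_left hΛ1 hΛpos.le).trans_eq (mul_one Λ)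
    calc ‖f.derivative.eval r‖ = ‖(f.derivative.eval r - g.derivative.eval r) + g.derivative.eval r‖ := by rw [sub_add_cancel]
      _ = max ‖f.derivative.eval r - g.derivative.eval r‖ ‖g.derivative.eval r‖ := IsUltrametricDist.norm_add_eq_max_of_norm_ne_norm h1.ne
      _ = Λ := max_eq_right h1.le
  -- strong Hensel for `f` at `r`
  have hH : ‖f.eval r‖ < ‖f.derivative.eval r‖ ^ 2 := by rw [hfd]; exact hfr.trans_lt hδ
  obtain ⟨r', hroot, hdist, hder⟩ := exists_isRoot_of_norm_eval_lt_sq hf hr hH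
  refine ⟨r', hroot, hdist.trans ?_, by rw [hder, hfd]⟩
  rw [hfd]
  exact div_le_div_of_nonneg_right hfr hΛpos.le

/-- **Finite-family form** (all the simple roots of the target move at once): for a family of roots `r j` of the integral `g` with `δ < ‖g′(r j)‖²` for every `j`, an
integral `f` with `‖fᵢ − gᵢ‖ ≤ δ` has, for every `j`, a root `r′` with `‖r′ − r j‖ ≤ δ ∕ ‖g′(r j)‖` and `‖f′(r′)‖ = ‖g′(r j)‖`. [cite: NeukirchANT1999, Ch. II (4.6)] -/
theorem forall_exists_isRoot_norm_sub_le_of_coeff_close [CompleteSpace K] {ι : Type*} {f g : K[X]} (hf : ∀ i, ‖f.coeff i‖ ≤ 1)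
    (hg : ∀ i, ‖g.coeff i‖ ≤ 1) (r : ι → K) (hr : ∀ j, ‖r j‖ ≤ 1) (hgr : ∀ j, g.IsRoot (r j)) {δ : ℝ}
    (hδ : ∀ j, δ < ‖g.derivative.eval (r j)‖ ^ 2) (hclose : ∀ i, ‖f.coeff i - g.coeff i‖ ≤ δ) (j : ι) :
    ∃ r' : K, f.IsRoot r' ∧ ‖r' - r j‖ ≤ δ / ‖g.derivative.eval (r j)‖ ∧ ‖f.derivative.eval r'‖ = ‖g.derivative.eval (r j)‖ :=
  exists_isRoot_norm_sub_le_of_coeff_close hf hg (hr j) (hgr j) (hδ j) hclose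

end Ultrametric

/-! ### The instance check at a finite place of a number field (`K := L_w`, Mathlib's normalised norm) -/

/-- **P2 at `K := L_w`**, the completion of a number field at a finite place (the consumer's field `L⁺_v`): the head `exists_isRoot_norm_sub_le_of_coeff_close`
applies verbatim (`L_w` is a complete ultrametric normed field). [cite: NeukirchANT1999, Ch. II (4.6)] -/
theorem exists_isRoot_norm_sub_le_of_coeff_close_adicCompletion {L : Type*} [Field L] [NumberField L] (w : HeightOneSpectrum (𝓞 L))
    {f g : (w.adicCompletion L)[X]} (hf : ∀ i, ‖f.coeff i‖ ≤ 1) (hg : ∀ i, ‖g.coeff i‖ ≤ 1)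
    {r : w.adicCompletion L} (hr : ‖r‖ ≤ 1) (hgr : g.IsRoot r) {δ : ℝ} (hδ : δ < ‖g.derivative.eval r‖ ^ 2)
    (hclose : ∀ i, ‖f.coeff i - g.coeff i‖ ≤ δ) :
    ∃ r' : w.adicCompletion L, f.IsRoot r' ∧ ‖r' - r‖ ≤ δ / ‖g.derivative.eval r‖ ∧ ‖f.derivative.eval r'‖ = ‖g.derivative.eval r‖ :=
  exists_isRoot_norm_sub_le_of_coeff_close hf hg hr hgr hδ hclose

end Summit.HodgeConjecture.HodgeConjecture.R90.S3

end
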